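import Literature.IUT.HodgeArakelov.LabelClassesOfCuspsHomogeneousGenuine
import Literature.IUT.HodgeArakelov.FlTorsorStructureConjCriterion
import HarnessLib

/-!
# [IUTchII] Def 2.3 (iii)/(v) at the GENUINE tower: `|LabCusp^±(Π̂^±_v)| = l` — input (ii) of the `𝔽^±_l`-torsor criterion, modulo cusp
# separation in the profinite completion

S. Mochizuki, *Inter-universal Teichmüller theory II*, kurims manuscript (Dec. 2020), §2 Def 2.3 (iii) p. 68 («`LabCusp^±(Π_⊆)` … the set
of `±`-label classes of cusps»; it has `l` elements: Def 2.3 (v) p. 69 «a natural `𝔽^±_l`-torsor structure on `LabCusp^±(Π_⊆)`»)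
[claim: Mochizuki2012, status: disputed] (IUTchII §2 Def 2.3 (iii), kurims p.68) (D-0012 claim key; record-only).  Inputs in print:
[AbsTopI] Lem 4.5 (vi) p. 55 («`I = C_Π(I ∩ Δ)`» for a decomposition group `I` of a cusp — cited BY Def 2.3 (ii) itself)
[cite: MochizukiAbsTopI2012, Lemma 4.5 (vi) p.55]; [SemiAnbd] Thm 6.5 (iii) p. 72 [cite: MochizukiSemiAnbd2006, Thm 6.5(iii) p.72];
[EtTh] Def 2.1 p. 36, Def 2.5 (i) p. 39 [cite: MochizukiEtTh2009, Def 2.5 (i) p.39].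

abc-iut cell, seat abc-iut-w5-d132 (gen 6), row «DEF23V-CARD-L» = input (ii) «`Nat.card (LabCuspPM C W.pmHat W.pmHat) = l`» of
abc-iut-w5-d243's criterion `FlTorsorStructureConj.nonempty_iff_conjStable_card_ker` (p440082) at abc-iut-L6-t19's genuine tower
`PlusMinusTower.ofCoverModel` / `ofPiCHat` (p430122) for the PROFINITE cuspidal datum of this seat's p432649, part 2 of 2.
PROOF-ONLY (no `def`, no instance, no new named fact).  The count is the group theory of `LabelClassesOfCuspsHomogeneousCount`
(`card_labCuspPM_eq_l_of_inputs`: orbit–stabiliser + index arithmetic `2l / 2 = l`) with its inputs DISCHARGED by part 1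
(`LabelClassesOfCuspsHomogeneousGenuine`): homogeneity (unique cusp `x₀`, `Π^tp_{X̲_v} ⊴ Π^tp_C` mod L02, `I_{x₀}` compact), the
inversion outside `Π̂_X` normalising `D̂ := ι(inclX D_{x₀})` (F-1674 BY NAME + «unique cusp»), `D̂ ≤ N(J₀)`, `J₀ = D̂ ∩ Ker Φ`,
`[Π̂^cor_v : Π̂^±_v] = 2l` (abc-iut-L6-t19 `ofCoverModel_indices`), `[Q : Π̂_X] = 2`.

THE ONE REMAINING BINDER `h45vi : N(J₀) ∩ Π̂_X ≤ D̂` — «the normaliser in `Π̂_X` of the cuspidal inertia group `Î_{x₀} = ι(inclX I_{x₀})` lies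
in the decomposition group `D̂_{x₀} = ι(inclX D_{x₀})`» — IS [AbsTopI] Lem 4.5 (vi) (FACT-LIST **F-0207** `CuspidalData.DecompEqCommensuratorOfInertia`,
`⊇`-direction; equivalently [AbsTopIII] Thm 1.11 (b) F-0405 `DecompEqNormalizer` / [GalSect] Thm 1.3 (ii) F-0103 `Thm_1_3_ii_cusps`)
AT THE INSTANCE `Π̂_X` = the closure of `ι(inclX Π^tp_X)` in the profinite completion `ι : Π^tp_C → Q`, `D̂_{x₀} = ι(inclX D_{x₀})` (the
[Mzk8] decomposition group; cf. abc-iut-f-174's `TemperedDecompositionOfProfinite`, binder `h13ii′`, and abc-iut-L6-t19's `hCT` = F-0438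
at the instance — the same currency).  It is cusp SEPARATION in the profinite completion, carried as a hypothesis, never asserted.

Results: `card_labCuspPM_ofCoverModel_eq_l` (parametric tower), `card_labCuspPM_ofPiCHat_eq_l` (tower of record; `S.l = l` definitionally),
and the criterion with (i)–(iii) DISCHARGED: `nonempty_flTorsorStructureConj_ofPiCHat_iff` — at the tower of record the Def 2.3 (v)
successor structure `FlTorsorStructureConj` EXISTS IFF (iv) «only `Π̂^±_v` fixes every label class» (mod `h45vi`).  WITHOUT `h45vi`:
`card_labCuspPM_ofCoverModel_dvd_l` — the count DIVIDES `l` unconditionally (so it is `1` or `l`).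

HONEST LABEL: theorems about the kernel's genuine tower over abc-iut-L2's [EtTh] interface data (`MuTwoSetting`, `CLevelData`,
`OncePuncturedData`, `DoubleUnderline`) modulo the printed inputs `hZ` (L02), `hN`, the origin clause «unique cusp», F-1674 and the ONE
profinite binder `h45vi`; nothing of the series is asserted; no side taken on [IUTchIII] Cor 3.12; typed ≠ proved; witnessed ≠ endorsed.
-/

noncomputable section

namespace Literature.IUT.HodgeArakelov

open Literature.AnabelianGeometry.EtaleTheta Literature.AnabelianGeometry.SemiGraphs
open scoped Pointwise

namespace PlusMinusTower

variable {p : ℕ} [Fact p.Prime] {M : MuTwoSetting p} (e : M.CLevelData)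
  {E : M.toThetaSetting.EtaleThetaData} {l : ℕ} (C : E.DoubleUnderline l) {N : ℕ+}
  (μ : M.toThetaSetting.CyclotomeMod l N) (hC : M.toThetaSetting.Compat) (hS : M.toThetaSetting.Sec2Hyps)
  (hl : l.Prime) (hp2 : p ≠ 2) (hpl : p ≠ l) (hζ : ∃ ζ : M.toThetaSetting.K, IsPrimitiveRoot ζ (4 * l))
  {η : (C.thetaEnvData μ hC hS).PiYdd → MuN p N} (hη : η ∈ (C.thetaEnvData μ hC hS).thetaCocycles)
  {Q : Type} [Group Q] [TopologicalSpace Q] [IsTopologicalGroup Q]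
  (ι : M.GtpC →ₜ* Q) (hι : IsProfiniteCompletion ι) (hinj : Function.Injective ι)
  (Φ : Q →* GQp p) (hΦ : ∀ g : M.GtpC, Φ (ι g) = e.augC g) (hΦK : Φ.range = M.GK)
  (hZ : Thm16Sub.KerToZIsCompactlyGenerated M.toThetaSetting) (hN : (C.Huu.subgroupOf (M.GtpXu l)).Normal)
  {P : TopGroup.{0}} (T : TemperedCoverings (BadPlaceSetting.ofUnderline C μ hC hS hl hp2 hpl hζ hη) P)

section Tower

variable {x₀ : M.Pt}

/-! ## 3. The count -/

/-- **`|LabCusp^±(Π̂^±_v)| = l` AT THE GENUINE TOWER `ofCoverModel`** (any injective profinite completion `ι : Π^tp_C → Q`), for every cuspidal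
datum with the p432649 characterisation — modulo the parameter bundle `op`, the origin clause «unique cusp» (`huniq`), [SemiAnbd] Thm 6.5 (iii)
(F-1674, BY NAME) and the ONE profinite binder `h45vi : N(ι inclX I_{x₀}) ∩ Π̂_X ≤ ι inclX D_{x₀}` = [AbsTopI] Lem 4.5 (vi) (F-0207; ≡ F-0405 /
F-0103) at the instance — cusp separation in the profinite completion.  This is input (ii) of abc-iut-w5-d243's Def 2.3 (v) criterion
(`S.l = l` definitionally for the Prop. 2.1 setting of record).  ([IUTchII] Def 2.3 (iii)/(v), kurims pp.68–69) [claim: Mochizuki2012, status: disputed] -/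
theorem card_labCuspPM_ofCoverModel_eq_l (op : M.toThetaSetting.OncePuncturedData) (hx₀ : M.IsCusp x₀)
    (huniq : ∀ x' : M.Pt, M.IsCusp x' → x' = x₀) (h65iii : M.toTemperedCurve.IsoPreservesCuspidalDecomp M.toTemperedCurve)
    (h45vi : Subgroup.normalizer ((((M.toTemperedCurve.inertia x₀).map M.inclX).map ι.toMonoidHom : Subgroup Q) : Set Q) ⊓
        (M.inclX.range.map ι.toMonoidHom).topologicalClosure ≤ ((M.decomp x₀).map M.inclX).map ι.toMonoidHom)
    (CuHat : CuspidalInertiaData (ofCoverModel e C μ hC hS hl hp2 hpl hζ hη ι hι hinj Φ hΦ hΦK hZ hN T))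
    (hCu : ∀ Q' J : Subgroup (ofCoverModel e C μ hC hS hl hp2 hpl hζ hη ι hι hinj Φ hΦ hΦK hZ hN T).Corhat,
      CuHat.IsCuspidalInertia Q' J ↔ J ≤ Q' ∧ ∃ i : {x : M.Pt // M.IsCusp x} × M.GtpC,
        ∃ γ ∈ (ofCoverModel e C μ hC hS hl hp2 hpl hζ hη ι hι hinj Φ hΦ hΦK hZ hN T).pmHat,
          J = MulAut.conj γ •
            ((((MulAut.conj i.2 • (M.toTemperedCurve.inertia i.1.1).map M.inclX) ⊓ (M.GtpXu l).map M.inclX).map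
              ι.toMonoidHom : Subgroup (ofCoverModel e C μ hC hS hl hp2 hpl hζ hη ι hι hinj Φ hΦ hΦK hZ hN T).Corhat)).topologicalClosure) :
    Nat.card (LabCuspPM CuHat (ofCoverModel e C μ hC hS hl hp2 hpl hζ hη ι hι hinj Φ hΦ hΦK hZ hN T).pmHat
      (ofCoverModel e C μ hC hS hl hp2 hpl hζ hη ι hι hinj Φ hΦ hΦK hZ hN T).pmHat) =
        (BadPlaceSetting.ofUnderline C μ hC hS hl hp2 hpl hζ hη).l := by
  let ιW : M.GtpC →* (ofCoverModel e C μ hC hS hl hp2 hpl hζ hη ι hι hinj Φ hΦ hΦK hZ hN T).Corhat := ι.toMonoidHom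
  obtain ⟨g, hgX, hgD⟩ := exists_ι_not_mem_closure_conj_map_decomp e ι hι hx₀ huniq h65iii
  refine card_labCuspPM_eq_l_of_inputs (C := CuHat)
    (J₀ := ((M.toTemperedCurve.inertia x₀).map M.inclX).map ιW)
    (Xh := (M.inclX.range.map ιW).topologicalClosure) (D := ((M.decomp x₀).map M.inclX).map ιW) (q₁ := ιW g)
    ?_ (isCuspidalInertia_pmHat_iff e C μ hC hS hl hp2 hpl hζ hη ι hι hinj Φ hΦ hΦK hZ hN T op hx₀ huniq CuHat hCu)
    ?_ ?_ ?_ ?_ ?_ ?_ ?_ ?_ ?_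
  · -- `J₀ ≤ Π̂^±_v`
    change (((M.toTemperedCurve.inertia x₀).map M.inclX).map ι.toMonoidHom : Subgroup Q) ≤
      (((M.GtpXu l).map M.inclX).map ι.toMonoidHom).topologicalClosure
    exact (Subgroup.map_mono (Subgroup.map_mono (inertia_le_GtpXu op hx₀))).trans (Subgroup.le_topologicalClosure _)
  · -- `[Q : Π̂_X] = 2`
    exact index_closure_range_inclX ι hι
  · -- `Π̂^±_v ≤ Π̂_X`
    change ((((M.GtpXu l).map M.inclX).map ι.toMonoidHom).topologicalClosure : Subgroup Q) ≤
      (M.inclX.range.map ι.toMonoidHom).topologicalClosure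
    exact Subgroup.topologicalClosure_mono (Subgroup.map_mono (Subgroup.map_le_range _ _))
  · -- `D̂ ≤ Π̂^±_v`
    change (((M.decomp x₀).map M.inclX).map ι.toMonoidHom : Subgroup Q) ≤
      (((M.GtpXu l).map M.inclX).map ι.toMonoidHom).topologicalClosure
    exact (Subgroup.map_mono (Subgroup.map_mono (decomp_le_GtpXu op hx₀))).trans (Subgroup.le_topologicalClosure _)
  · -- `D̂ ≤ N(J₀)`
    exact map_decomp_le_normalizer_map_inertia ι
  · -- SEPARATION (the binder)
    exact h45vi
  · -- `J₀` stable under `N(D̂)`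
    exact fun q hq => conj_smul_map_inertia_of_decomp e ι Φ hΦ q hq
  · -- the inversion lies outside `Π̂_X`
    exact hgX
  · -- … and normalises `D̂`
    exact hgD
  · -- `[Π̂^cor_v : Π̂^±_v] = 2l`
    exact (ofCoverModel_indices e C μ hC hS hl hp2 hpl hζ hη ι hι hinj Φ hΦ hΦK hZ hN T).1

/-- **WITHOUT the separation binder: the count DIVIDES `l`** (so `|LabCusp^±(Π̂^±_v)| ∈ {1, l}`) — from homogeneity, `[Π̂^cor_v : Π̂^±_v] = 2l`
and the inversion alone. ([IUTchII] Def 2.3 (iii), kurims p.68) [claim: Mochizuki2012, status: disputed] -/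
theorem card_labCuspPM_ofCoverModel_dvd_l (op : M.toThetaSetting.OncePuncturedData) (hx₀ : M.IsCusp x₀)
    (huniq : ∀ x' : M.Pt, M.IsCusp x' → x' = x₀) (h65iii : M.toTemperedCurve.IsoPreservesCuspidalDecomp M.toTemperedCurve)
    (CuHat : CuspidalInertiaData (ofCoverModel e C μ hC hS hl hp2 hpl hζ hη ι hι hinj Φ hΦ hΦK hZ hN T))
    (hCu : ∀ Q' J : Subgroup (ofCoverModel e C μ hC hS hl hp2 hpl hζ hη ι hι hinj Φ hΦ hΦK hZ hN T).Corhat,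
      CuHat.IsCuspidalInertia Q' J ↔ J ≤ Q' ∧ ∃ i : {x : M.Pt // M.IsCusp x} × M.GtpC,
        ∃ γ ∈ (ofCoverModel e C μ hC hS hl hp2 hpl hζ hη ι hι hinj Φ hΦ hΦK hZ hN T).pmHat,
          J = MulAut.conj γ •
            ((((MulAut.conj i.2 • (M.toTemperedCurve.inertia i.1.1).map M.inclX) ⊓ (M.GtpXu l).map M.inclX).map
              ι.toMonoidHom : Subgroup (ofCoverModel e C μ hC hS hl hp2 hpl hζ hη ι hι hinj Φ hΦ hΦK hZ hN T).Corhat)).topologicalClosure) :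
    Nat.card (LabCuspPM CuHat (ofCoverModel e C μ hC hS hl hp2 hpl hζ hη ι hι hinj Φ hΦ hΦK hZ hN T).pmHat
      (ofCoverModel e C μ hC hS hl hp2 hpl hζ hη ι hι hinj Φ hΦ hΦK hZ hN T).pmHat) ∣
        (BadPlaceSetting.ofUnderline C μ hC hS hl hp2 hpl hζ hη).l := by
  let ιW : M.GtpC →* (ofCoverModel e C μ hC hS hl hp2 hpl hζ hη ι hι hinj Φ hΦ hΦK hZ hN T).Corhat := ι.toMonoidHom
  obtain ⟨g, hgX, hgD⟩ := exists_ι_not_mem_closure_conj_map_decomp e ι hι hx₀ huniq h65iii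
  have hgJ := conj_smul_map_inertia_of_decomp e ι Φ hΦ (ι g) hgD
  refine card_labCuspPM_dvd_l (C := CuHat) (J₀ := ((M.toTemperedCurve.inertia x₀).map M.inclX).map ιW)
    (Xh := (M.inclX.range.map ιW).topologicalClosure) (q₁ := ιW g) ?_
    (isCuspidalInertia_pmHat_iff e C μ hC hS hl hp2 hpl hζ hη ι hι hinj Φ hΦ hΦK hZ hN T op hx₀ huniq CuHat hCu)
    (index_closure_range_inclX ι hι) ?_ hgX ?_
    (ofCoverModel_indices e C μ hC hS hl hp2 hpl hζ hη ι hι hinj Φ hΦ hΦK hZ hN T).1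
  · change (((M.toTemperedCurve.inertia x₀).map M.inclX).map ι.toMonoidHom : Subgroup Q) ≤
      (((M.GtpXu l).map M.inclX).map ι.toMonoidHom).topologicalClosure
    exact (Subgroup.map_mono (Subgroup.map_mono (inertia_le_GtpXu op hx₀))).trans (Subgroup.le_topologicalClosure _)
  · change ((((M.GtpXu l).map M.inclX).map ι.toMonoidHom).topologicalClosure : Subgroup Q) ≤
      (M.inclX.range.map ι.toMonoidHom).topologicalClosure
    exact Subgroup.topologicalClosure_mono (Subgroup.map_mono (Subgroup.map_le_range _ _))
  · -- `ι g` normalises `J₀` and `Π̂^±_v`, hence `N(J₀) ∩ Π̂^±_v`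
    have hgJ' : MulAut.conj (ιW g) • ((M.toTemperedCurve.inertia x₀).map M.inclX).map ιW =
        ((M.toTemperedCurve.inertia x₀).map M.inclX).map ιW := hgJ
    rw [Subgroup.smul_inf, Subgroup.Normal.conj_smul_eq_self (ιW g)
        (ofCoverModel e C μ hC hS hl hp2 hpl hζ hη ι hι hinj Φ hΦ hΦK hZ hN T).pmHat,
      ← Literature.AnabelianGeometry.EtaleTheta.normalizer_conj_smul, hgJ']

end Tower

/-! ## 4. The tower of record `ofPiCHat` -/

section PiCHat

variable {x₀ : M.Pt}

/-- **`|LabCusp^±(Π̂^±_v)| = l` AT THE TOWER OF RECORD `ofPiCHat`** (inside abc-iut-L2-d3's `Π_C`), verbatim from the parametric statement.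
([IUTchII] Def 2.3 (iii)/(v), kurims pp.68–69) [claim: Mochizuki2012, status: disputed] -/
theorem card_labCuspPM_ofPiCHat_eq_l (op : M.toThetaSetting.OncePuncturedData) (hx₀ : M.IsCusp x₀)
    (huniq : ∀ x' : M.Pt, M.IsCusp x' → x' = x₀) (h65iii : M.toTemperedCurve.IsoPreservesCuspidalDecomp M.toTemperedCurve)
    (h45vi : Subgroup.normalizer ((((M.toTemperedCurve.inertia x₀).map M.inclX).map e.toPiCHat.toMonoidHom : Subgroup e.PiCHat) :
        Set e.PiCHat) ⊓ (M.inclX.range.map e.toPiCHat.toMonoidHom).topologicalClosure ≤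
          ((M.decomp x₀).map M.inclX).map e.toPiCHat.toMonoidHom)
    (CuHat : CuspidalInertiaData (ofPiCHat e C μ hC hS hl hp2 hpl hζ hη hZ hN T))
    (hCu : ∀ Q' J : Subgroup (ofPiCHat e C μ hC hS hl hp2 hpl hζ hη hZ hN T).Corhat,
      CuHat.IsCuspidalInertia Q' J ↔ J ≤ Q' ∧ ∃ i : {x : M.Pt // M.IsCusp x} × M.GtpC,
        ∃ γ ∈ (ofPiCHat e C μ hC hS hl hp2 hpl hζ hη hZ hN T).pmHat,
          J = MulAut.conj γ •
            ((((MulAut.conj i.2 • (M.toTemperedCurve.inertia i.1.1).map M.inclX) ⊓ (M.GtpXu l).map M.inclX).map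
              e.toPiCHat.toMonoidHom : Subgroup (ofPiCHat e C μ hC hS hl hp2 hpl hζ hη hZ hN T).Corhat)).topologicalClosure) :
    Nat.card (LabCuspPM CuHat (ofPiCHat e C μ hC hS hl hp2 hpl hζ hη hZ hN T).pmHat
      (ofPiCHat e C μ hC hS hl hp2 hpl hζ hη hZ hN T).pmHat) = l :=
  card_labCuspPM_ofCoverModel_eq_l e C μ hC hS hl hp2 hpl hζ hη e.toPiCHat e.isProfiniteCompletion_toPiCHat
    e.toPiCHat_injective e.piCData.aug.toMonoidHom (fun g => e.piCData_aug_apply g) e.piCData.range_aug hZ hN T op hx₀ huniq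
    h65iii h45vi CuHat hCu

/-- **The Def 2.3 (v) successor structure at the tower of record EXISTS IFF (iv)** «only `Π̂^±_v` fixes every `±`-label class by
conjugation»: inputs (i) law (a) (`conjStable_ofCoverModel`), (ii) `|LabCusp^±| = l` (this file, mod `h45vi`), (iii) `[Π̂^cor_v : Π̂^±_v] = 2l`
(abc-iut-w5-d243 `index_pmHat`) of abc-iut-w5-d243's criterion are DISCHARGED; (iv) (faithfulness) is what remains.
([IUTchII] Def 2.3 (v), kurims p.69) [claim: Mochizuki2012, status: disputed] -/
theorem nonempty_flTorsorStructureConj_ofPiCHat_iff (op : M.toThetaSetting.OncePuncturedData) (hx₀ : M.IsCusp x₀)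
    (huniq : ∀ x' : M.Pt, M.IsCusp x' → x' = x₀) (h65iii : M.toTemperedCurve.IsoPreservesCuspidalDecomp M.toTemperedCurve)
    (h45vi : Subgroup.normalizer ((((M.toTemperedCurve.inertia x₀).map M.inclX).map e.toPiCHat.toMonoidHom : Subgroup e.PiCHat) :
        Set e.PiCHat) ⊓ (M.inclX.range.map e.toPiCHat.toMonoidHom).topologicalClosure ≤
          ((M.decomp x₀).map M.inclX).map e.toPiCHat.toMonoidHom)
    (CuHat : CuspidalInertiaData (ofPiCHat e C μ hC hS hl hp2 hpl hζ hη hZ hN T))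
    (hCu : ∀ Q' J : Subgroup (ofPiCHat e C μ hC hS hl hp2 hpl hζ hη hZ hN T).Corhat,
      CuHat.IsCuspidalInertia Q' J ↔ J ≤ Q' ∧ ∃ i : {x : M.Pt // M.IsCusp x} × M.GtpC,
        ∃ γ ∈ (ofPiCHat e C μ hC hS hl hp2 hpl hζ hη hZ hN T).pmHat,
          J = MulAut.conj γ •
            ((((MulAut.conj i.2 • (M.toTemperedCurve.inertia i.1.1).map M.inclX) ⊓ (M.GtpXu l).map M.inclX).map
              e.toPiCHat.toMonoidHom : Subgroup (ofPiCHat e C μ hC hS hl hp2 hpl hζ hη hZ hN T).Corhat)).topologicalClosure) :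
    Nonempty (FlTorsorStructureConj CuHat) ↔
      ∀ g : (ofPiCHat e C μ hC hS hl hp2 hpl hζ hη hZ hN T).Corhat,
        (∀ t, (conjStable_ofCoverModel e C μ hC hS hl hp2 hpl hζ hη e.toPiCHat e.isProfiniteCompletion_toPiCHat
            e.toPiCHat_injective e.piCData.aug.toMonoidHom (fun g => e.piCData_aug_apply g) e.piCData.range_aug hZ hN T
            op hx₀ huniq CuHat hCu).conjClass g t = t) →
          g ∈ (ofPiCHat e C μ hC hS hl hp2 hpl hζ hη hZ hN T).pmHat := by
  have hcard := card_labCuspPM_ofPiCHat_eq_l e C μ hC hS hl hp2 hpl hζ hη hZ hN T op hx₀ huniq h65iii h45vi CuHat hCu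
  rw [FlTorsorStructureConj.nonempty_iff_conjStable_card_ker]
  constructor
  · rintro ⟨hC', -, hker⟩
    exact hker
  · intro hker
    exact ⟨_, hcard, hker⟩

end PiCHat

end PlusMinusTower

end Literature.IUT.HodgeArakelov

end
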